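import Summits.AtomisticToContinuum.FouriersLaw.Theorems.LatticeLandauDampingAbelThermodynamicLimitOpenChainSeveredLocalityPathwise
import Summits.AtomisticToContinuum.FouriersLaw.Theorems.LatticeLandauDampingAbelThermodynamicLimitOpenChainSeveredLocalityInvariance
import Summits.AtomisticToContinuum.FouriersLaw.Theorems.LatticeLandauDampingAbelThermodynamicLimitUniformAnchoredCorrelationTailsBoxSet
import Summits.AtomisticToContinuum.FouriersLaw.Theorems.JunctionLocalityNonBallisticLightConeAssemblyPart2d
import Literature.MathematicalPhysics.KineticTheory.InfiniteChainObservables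
import Summits.AtomisticToContinuum.FouriersLaw.Theorems.BoundaryKubo.Negative.Reflection

/-!
# Open chain versus severed window: exceptional set of the severed flow and the pathwise current comparison (stub (M1sev))

Helper (`--supports stmt-AtomisticToContinuum-14013`) for the line `series-law-at-every-laplace-frequency`
(SketchIdeator2) of the crux `LatticeLandauDamping.AbelThermodynamicLimit`, stub (M1sev)
`stub_openChainSeveredLocality`. Registered sub-goal `pinnedChain_severedWindow_exceptionalSet`.

Two inputs of the fixed-scale `L²` estimate `…OpenChainSeveredLocalityEstimate`: `severed_excSet` (registered) — under
the free Gibbs state `μ_{N,T}`, the set where some time-integrated squared momentum along LLL's severed flow of the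
window `[k-M, k+1+M]` (from the embedded configuration) exceeds its weighted threshold `ρ²√(1+|l-k|)/(4τ)` has measure
`≤ 4^{16}C_pτ^{32}·4/ρ^{32}`, uniformly in `N`, `M`, `k` (union bound, the `N`-uniform tail `timeIntegral_tail_severed`,
`Σ_l (1+|l-k|)^{-2} ≤ 4`); `pathwise_current_sq_le` — on the good event (weighted position box of the strong solution on
`[0, τ]`, weighted time-integrated momentum bounds along the severed flow) the kinematics `q(s)² ≤ 2q(0)² + 2τ∫₀^τ p²`,
the pathwise core `central_bond_estimate` with `R² = 3ρ²√(3+M)` and the polynomial Lipschitz bound of the current give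
`(j_k(Φ_t(z,w)) − j_k(T^Λ_t ι z))² ≤ A₁ + A₂ (p_k + p_{k+1})²(T^Λ_t ι z)`, `A₁, A₂ = O(R⁶Θ 4^{-2M})`.
Folklore; no definitions.
-/

noncomputable section

open MeasureTheory ProbabilityTheory Set Filter Topology
open scoped NNReal ENNReal BigOperators

namespace Summit.AtomisticToContinuum.FouriersLaw.Theorems.AbelThermodynamicLimit.SeriesLawAtEveryLaplaceFrequency

open Literature.MathematicalPhysics.KineticTheory Literature.MathematicalPhysics.KineticTheory.HeatConduction
open Literature.Probability.Process OscillatorChain BulkWindow BoxTail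
open Summit.AtomisticToContinuum.FouriersLaw.Theorems.NonBallistic
open Summit.AtomisticToContinuum.FouriersLaw.Theorems.NonBallistic.LightConePropagation (abs_cubic_sub_cubic_le)
open Summit.AtomisticToContinuum.FouriersLaw.Theorems.PhononMeanFreePath (commonPastBound_gibbsEvenMoments)
open Summit.AtomisticToContinuum.FouriersLaw.Theorems.BoundaryKubo.Negative.Reflection (bondCurrent_eq_of_lt)

namespace SeveredLocality

variable {N : ℕ} {ω₂ lam β γ : ℝ}

/-! ### Deterministic pieces: the current, kinematics of the severed flow -/

/-- **Polynomial Lipschitz bound for the bond current of the pinned chain** (`V'(r) = r + βr³`): with all four positions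
in `[-R, R]`, position differences `≤ δq` and momentum differences `≤ δp`,
`(j(p, q) - j(p', q'))² ≤ 2(2R + 8βR³)² δp² + 2(1 + 12βR²)² δq² (p'_k + p'_{k+1})²`. [folklore] -/
theorem sq_current_sub_le (hβ : 0 ≤ β) {R δq δp pk pk1 qk qk1 pk' pk1' qk' qk1' : ℝ}
    (hqk : |qk| ≤ R) (hqk1 : |qk1| ≤ R) (hqk' : |qk'| ≤ R) (hqk1' : |qk1'| ≤ R)
    (hdq : |qk - qk'| ≤ δq) (hdq1 : |qk1 - qk1'| ≤ δq) (hdp : |pk - pk'| ≤ δp) (hdp1 : |pk1 - pk1'| ≤ δp) :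
    (-((pk + pk1) / 2 * ((qk1 - qk) + β * (qk1 - qk) ^ 3)) -
        -((pk' + pk1') / 2 * ((qk1' - qk') + β * (qk1' - qk') ^ 3))) ^ 2 ≤
      2 * (2 * R + 8 * β * R ^ 3) ^ 2 * δp ^ 2 + 2 * (1 + 12 * β * R ^ 2) ^ 2 * δq ^ 2 * (pk' + pk1') ^ 2 := by
  have hR : 0 ≤ R := (abs_nonneg _).trans hqk; have hδp : 0 ≤ δp := (abs_nonneg _).trans hdp
  set r := qk1 - qk with hr; set r' := qk1' - qk' with hr'
  have h2r : |r| ≤ 2 * R := (abs_sub _ _).trans (by linarith)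
  have h2r' : |r'| ≤ 2 * R := (abs_sub _ _).trans (by linarith)
  -- `|W(r)| ≤ 2R + 8βR³`
  have hW : |r + β * r ^ 3| ≤ 2 * R + 8 * β * R ^ 3 := by
    refine (abs_add_le _ _).trans ?_
    rw [abs_mul, abs_of_nonneg hβ, abs_pow]
    linarith [mul_le_mul_of_nonneg_left (pow_le_pow_left₀ (abs_nonneg _) h2r 3) hβ]
  -- `|W(r) - W(r')| ≤ (1 + 12βR²) · 2δq`
  have hdW : |(r + β * r ^ 3) - (r' + β * r' ^ 3)| ≤ (1 + 12 * β * R ^ 2) * (2 * δq) := by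
    have h := abs_cubic_sub_cubic_le (c₁ := 1) zero_le_one hβ h2r h2r'
    rw [one_mul, one_mul, show (1 + 3 * β * (2 * R) ^ 2) = 1 + 12 * β * R ^ 2 by ring] at h
    refine h.trans (mul_le_mul_of_nonneg_left ?_ (by positivity))
    calc |r - r'| = |(qk1 - qk1') - (qk - qk')| := by rw [hr, hr']; ring_nf
      _ ≤ |qk1 - qk1'| + |qk - qk'| := abs_sub _ _
      _ ≤ 2 * δq := by linarith
  have hdS : |(pk + pk1) - (pk' + pk1')| ≤ 2 * δp :=
    calc |(pk + pk1) - (pk' + pk1')| = |(pk - pk') + (pk1 - pk1')| := by ring_nf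
      _ ≤ |pk - pk'| + |pk1 - pk1'| := abs_add_le _ _
      _ ≤ 2 * δp := by linarith
  -- the difference
  have key : -((pk + pk1) / 2 * (r + β * r ^ 3)) - -((pk' + pk1') / 2 * (r' + β * r' ^ 3)) =
      -(1 / 2) * (((pk + pk1) - (pk' + pk1')) * (r + β * r ^ 3) +
        (pk' + pk1') * ((r + β * r ^ 3) - (r' + β * r' ^ 3))) := by ring
  have habs : |-((pk + pk1) / 2 * (r + β * r ^ 3)) - -((pk' + pk1') / 2 * (r' + β * r' ^ 3))| ≤
      δp * (2 * R + 8 * β * R ^ 3) + |pk' + pk1'| * ((1 + 12 * β * R ^ 2) * δq) := by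
    rw [key, abs_mul, show |-(1 / 2 : ℝ)| = 1 / 2 by norm_num]
    have h1 : |((pk + pk1) - (pk' + pk1')) * (r + β * r ^ 3)| ≤ 2 * δp * (2 * R + 8 * β * R ^ 3) := by
      rw [abs_mul]; exact mul_le_mul hdS hW (abs_nonneg _) (by positivity)
    have h2 : |(pk' + pk1') * ((r + β * r ^ 3) - (r' + β * r' ^ 3))| ≤
        |pk' + pk1'| * ((1 + 12 * β * R ^ 2) * (2 * δq)) := by
      rw [abs_mul]; exact mul_le_mul_of_nonneg_left hdW (abs_nonneg _)
    have := (abs_add_le _ _).trans (add_le_add h1 h2)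
    linarith
  set u : ℝ := δp * (2 * R + 8 * β * R ^ 3) with hu
  set v : ℝ := |pk' + pk1'| * ((1 + 12 * β * R ^ 2) * δq) with hv
  have hsq := pow_le_pow_left₀ (abs_nonneg _) habs 2
  rw [sq_abs] at hsq
  calc _ ≤ (u + v) ^ 2 := hsq
    _ ≤ (u + v) ^ 2 + (u - v) ^ 2 := le_add_of_nonneg_right (sq_nonneg _)
    _ = 2 * u ^ 2 + 2 * v ^ 2 := by ring
    _ = _ := by rw [hu, hv, mul_pow, mul_pow, mul_pow, sq_abs]; ring

/-- **Kinematics of the severed flow**: for a site `i ∈ Λ` and `0 ≤ s ≤ t`,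
`q_i(T^Λ_s σ)² ≤ 2 q_i(σ)² + 2t ∫₀ᵗ p_i(T^Λ_r σ)² dr` (Cauchy–Schwarz in time). [folklore] -/
theorem severedFlow_position_sq_le (hB1 : (pinnedChain ω₂ lam β γ).CondB1) (Λ : Finset ℤ) (σ : ChainConfig)
    {i : ℤ} (hi : i ∈ Λ) {t s : ℝ} (hs : s ∈ Icc (0:ℝ) t) :
    (severedFlow hB1 Λ s σ i).1 ^ 2 ≤
      2 * (σ i).1 ^ 2 + 2 * t * ∫ r in (0:ℝ)..t, (severedFlow hB1 Λ r σ i).2 ^ 2 := by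
  -- adapted from `NonBallistic.pinnedChain_chainFlow_position_sq_le`
  have hpc : Continuous fun r => (severedFlow hB1 Λ r σ i).2 :=
    continuous_snd.comp ((continuous_apply i).comp (continuous_severedFlow_curve hB1 Λ σ))
  obtain ⟨hq, -⟩ := severedFlow_apply_integral ω₂ lam β γ hB1 Λ σ hi s
  have hcs := sq_intervalIntegral_le_mul_intervalIntegral_sq hpc hs.1
  have hmono : ∫ r in (0:ℝ)..s, (severedFlow hB1 Λ r σ i).2 ^ 2 ≤ ∫ r in (0:ℝ)..t, (severedFlow hB1 Λ r σ i).2 ^ 2 :=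
    intervalIntegral.integral_mono_interval le_rfl hs.1 hs.2 (Eventually.of_forall fun r => sq_nonneg _)
      ((hpc.pow 2).intervalIntegrable 0 t)
  have hJ0 : 0 ≤ ∫ r in (0:ℝ)..s, (severedFlow hB1 Λ r σ i).2 ^ 2 :=
    intervalIntegral.integral_nonneg hs.1 fun r _ => sq_nonneg _
  have hst : s * ∫ r in (0:ℝ)..s, (severedFlow hB1 Λ r σ i).2 ^ 2 ≤
      t * ∫ r in (0:ℝ)..t, (severedFlow hB1 Λ r σ i).2 ^ 2 := mul_le_mul hs.2 hmono hJ0 (hs.1.trans hs.2)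
  rw [hq]
  nlinarith [sq_nonneg ((σ i).1 - ∫ r in (0:ℝ)..s, (severedFlow hB1 Λ r σ i).2)]


/-! ### The exceptional set of the severed flow -/

section Severed

variable (hω : 0 < ω₂) (hl : 0 ≤ lam) (hβ : 0 ≤ β) {T : ℝ} (hT : 0 < T)
  (hB1 : (pinnedChain ω₂ lam β γ).CondB1) (e : Fin N ≃ ↥(Finset.Icc (0 : ℤ) (0 + N - 1)))
  (he : ∀ k : Fin N, ((e k : ↥(Finset.Icc (0 : ℤ) (0 + N - 1))) : ℤ) = 0 + k) (η₀ : ChainConfig)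

/-- The bonds of the window `[k-M, k+1+M]`, `M + 2 ≤ k`, `k + M + 3 < N`, are interior bonds of the chain. [folklore] -/
theorem bondSet_window_subset (k : Fin N) {M : ℕ} (hk : M + 2 ≤ k.val) (hkN : k.val + M + 3 < N) :
    bondSet (Finset.Icc ((k.val : ℤ) - M) ((k.val : ℤ) + 1 + M)) ⊆ Finset.Icc (0 : ℤ) (0 + N - 2) := by
  intro y hy
  rcases mem_bondSet_iff.1 hy with h | h <;>
  · simp only [Finset.mem_Icc] at h ⊢; omega

include hω hl hβ hT he in
/-- **The exceptional set of the severed flow is small, uniformly in `N`, in the window and in the centre**: the set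
where some time-integrated squared momentum along `T^Λ_r(ι z)` exceeds its weighted threshold
`ρ²√(1+|l-k|)/(4τ)` is measurable of `μ_{N,T}`-measure `≤ 4^{16} C_p τ^{32} · 4/ρ^{32}`, `C_p = T^{16}∏_{j<16}(2j+1)`
(union bound, `timeIntegral_tail_severed`, `Σ_l (1+|l-k|)^{-2} ≤ 4`). [folklore] -/
theorem severed_excSet (k : Fin N) {M : ℕ} (hk : M + 2 ≤ k.val) (hkN : k.val + M + 3 < N) {ρ τ : ℝ}
    (hρ : 1 ≤ ρ) (hτ : 0 < τ) :
    MeasurableSet {z : PhaseSpace N | ∃ l : Fin N,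
        ρ ^ 2 * Real.sqrt (1 + ((((l : ℕ) : ℤ) - k).natAbs : ℝ)) / (4 * τ) <
          ∫ r in (0:ℝ)..τ, (severedFlow hB1 (Finset.Icc ((k.val : ℤ) - M) ((k.val : ℤ) + 1 + M)) r
            (embed (Finset.Icc (0 : ℤ) (0 + N - 1)) e η₀ z) ((l : ℕ) : ℤ)).2 ^ 2} ∧
    (pinnedChain ω₂ lam β γ).gibbsMeasure N T {z : PhaseSpace N | ∃ l : Fin N,
        ρ ^ 2 * Real.sqrt (1 + ((((l : ℕ) : ℤ) - k).natAbs : ℝ)) / (4 * τ) <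
          ∫ r in (0:ℝ)..τ, (severedFlow hB1 (Finset.Icc ((k.val : ℤ) - M) ((k.val : ℤ) + 1 + M)) r
            (embed (Finset.Icc (0 : ℤ) (0 + N - 1)) e η₀ z) ((l : ℕ) : ℤ)).2 ^ 2} ≤
      ENNReal.ofReal (4 ^ 16 * (T ^ 16 * ∏ j ∈ Finset.range 16, (2 * (j : ℝ) + 1)) * τ ^ 32 / ρ ^ 32 * 4) := by
  -- adapted from `BoxTail.measure_exc_le` (strong solution there, severed flow here)
  set P := pinnedChain ω₂ lam β γ with hP
  set μ := P.gibbsMeasure N T with hμ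
  set Λ : Finset ℤ := Finset.Icc ((k.val : ℤ) - M) ((k.val : ℤ) + 1 + M) with hΛ
  set ι := embed (Finset.Icc (0 : ℤ) (0 + N - 1)) e η₀ with hι
  set Cp : ℝ := T ^ 16 * ∏ j ∈ Finset.range 16, (2 * (j : ℝ) + 1) with hCp
  have hCp0 : 0 ≤ Cp := by
    rw [hCp]; exact mul_nonneg (pow_nonneg hT.le _) (Finset.prod_nonneg fun j _ => by positivity)
  have hΛb : bondSet Λ ⊆ Finset.Icc (0 : ℤ) (0 + N - 2) := bondSet_window_subset k hk hkN
  set g : Fin N → ℝ := fun l => Real.sqrt (1 + ((((l : ℕ) : ℤ) - k).natAbs : ℝ)) with hg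
  have hg1 : ∀ l, 1 ≤ g l := fun l => weight_one_le _
  have hθ0 : ∀ l, 0 < ρ ^ 2 * g l / (4 * τ) := fun l => by have := hg1 l; positivity
  set f : Fin N → PhaseSpace N → ℝ := fun l z =>
    ∫ r in (0:ℝ)..τ, (severedFlow hB1 Λ r (ι z) ((l : ℕ) : ℤ)).2 ^ 2 with hf
  have hfm : ∀ l, Measurable (f l) := fun l =>
    measurable_intervalIntegral_of_continuous_of_measurable
      (u := fun r z => (severedFlow hB1 Λ r (ι z) ((l : ℕ) : ℤ)).2 ^ 2)
      (fun z => (continuous_snd.comp ((continuous_apply _).comp (continuous_severedFlow_curve hB1 Λ _))).pow 2)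
      (fun r => ((measurable_snd.comp ((measurable_pi_apply _).comp
        (measurable_severedFlow_embed γ hB1 e Λ η₀ r))).pow_const 2)) τ
  set S : Fin N → Set (PhaseSpace N) := fun l => {z | ρ ^ 2 * g l / (4 * τ) < f l z} with hS
  have hSm : ∀ l, MeasurableSet (S l) := fun l => measurableSet_lt measurable_const (hfm l)
  have hE : {z : PhaseSpace N | ∃ l : Fin N, ρ ^ 2 * g l / (4 * τ) < f l z} = ⋃ l, S l := by
    ext z; simp [hS]
  refine ⟨by rw [hE]; exact MeasurableSet.iUnion hSm, ?_⟩
  set K₁ : ℝ := 4 ^ 16 * Cp * τ ^ 32 / ρ ^ 32 with hK₁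
  have hK₁0 : 0 ≤ K₁ := by have := lt_of_lt_of_le one_pos hρ; positivity
  have hpiece : ∀ l, μ (S l) ≤ ENNReal.ofReal (K₁ * (1 / (1 + ((((l : ℕ) : ℤ) - k).natAbs : ℝ)) ^ 2)) := by
    intro l
    refine (timeIntegral_tail_severed γ hω hl hβ hT hB1 e he hΛb η₀ hτ.le (hθ0 l) l).trans
      (ENNReal.ofReal_le_ofReal ?_)
    have e2 : Cp * τ ^ 16 / (ρ ^ 2 * g l / (4 * τ)) ^ 16 = 4 ^ 16 * Cp * τ ^ 32 / (ρ ^ 2 * g l) ^ 16 := by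
      rw [div_pow, mul_pow]; field_simp
    rw [← hCp, e2]
    exact inv_theta_pow_le hρ _ (by positivity)
  rw [hE]
  calc μ (⋃ l, S l) ≤ ∑ l : Fin N, μ (S l) := measure_iUnion_fintype_le _ _
    _ ≤ ∑ l : Fin N, ENNReal.ofReal (K₁ * (1 / (1 + ((((l : ℕ) : ℤ) - k).natAbs : ℝ)) ^ 2)) :=
        Finset.sum_le_sum fun l _ => hpiece l
    _ = ENNReal.ofReal (∑ l : Fin N, K₁ * (1 / (1 + ((((l : ℕ) : ℤ) - k).natAbs : ℝ)) ^ 2)) :=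
        (ENNReal.ofReal_sum_of_nonneg fun l _ => by positivity).symm
    _ ≤ ENNReal.ofReal (K₁ * 4) := ENNReal.ofReal_le_ofReal (by
        rw [← Finset.mul_sum]; exact mul_le_mul_of_nonneg_left (sum_inv_sq_dist_le k) hK₁0)

end Severed

/-! ### The pathwise current comparison -/

section Window

variable (hB1 : (pinnedChain ω₂ lam β γ).CondB1) (e : Fin N ≃ ↥(Finset.Icc (0 : ℤ) (0 + N - 1)))
  (he : ∀ k : Fin N, ((e k : ↥(Finset.Icc (0 : ℤ) (0 + N - 1))) : ℤ) = 0 + k) (η₀ : ChainConfig)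

include he in
/-- The infinite-chain current at the embedded configuration is the finite-chain current. [folklore] -/
theorem bondCurrentZ_embed (k : Fin N) (hk1 : k.val + 1 < N) (z : PhaseSpace N) :
    (pinnedChain ω₂ lam β γ).bondCurrentZ (embed (Finset.Icc (0 : ℤ) (0 + N - 1)) e η₀ z) (k.val : ℤ) =
      (pinnedChain ω₂ lam β γ).bondCurrent N k z := by
  rw [bondCurrent_eq_of_lt _ hk1, OscillatorChain.bondCurrentZ]
  have h0 : embed (Finset.Icc (0 : ℤ) (0 + N - 1)) e η₀ z (k.val : ℤ) = (z.1 k, z.2 k) := embed_Icc_zero_apply e he η₀ z k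
  have h1 : embed (Finset.Icc (0 : ℤ) (0 + N - 1)) e η₀ z ((k.val : ℤ) + 1) = (z.1 ⟨k.val + 1, hk1⟩, z.2 ⟨k.val + 1, hk1⟩) := by
    rw [show ((k.val : ℤ) + 1) = (((⟨k.val + 1, hk1⟩ : Fin N) : ℕ) : ℤ) by push_cast; ring, embed_Icc_zero_apply e he]
  simp only [h0, h1]

include he in
/-- **The pathwise current comparison on the good event.** With the window `Λ = [k-M, k+1+M]` (`M + 2 ≤ k`,
`k + M + 3 < N`), the scales `R² = 3ρ²√(3+M)`, `Θ = ω₂ + 3 lam R² + 4(1+12βR²)` in the regime `2e√Θ τ ≤ 2M+1`: if the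
positions of the strong solution `Φ_s(z, w)` obey the weighted box `q_l² ≤ ρ²√(1+|l-k|)` on `[0, τ]` and the
time-integrated squared momenta along the severed flow obey `∫₀^τ p_l(T^Λ_r ι z)² dr ≤ ρ²√(1+|l-k|)/(4τ)`, then at every
`t ∈ [0, τ]` the two central currents satisfy
`(j_k(Φ_t(z,w)) − j_k(T^Λ_t ι z))² ≤ 2(2R+8βR³)²δp² + 2(1+12βR²)²δq² (p_k + p_{k+1})²(T^Λ_t ι z)`,
`δq = 2R·2^{-(2M+2)}`, `δp = 2R√Θ·2^{-(2M+1)}` (kinematics of the severed flow, the pathwise core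
`central_bond_estimate`, and the polynomial Lipschitz bound of the current). [folklore] -/
theorem pathwise_current_sq_le (hω : 0 < ω₂) (hl : 0 ≤ lam) (hβ : 0 ≤ β) (hγ : 0 ≤ γ) (T : ℝ)
    (k : Fin N) {M : ℕ} (hk : M + 2 ≤ k.val) (hkN : k.val + M + 3 < N) {ρ τ : ℝ} (hτ : 0 < τ)
    {R2 R Θ : ℝ} (hR2 : R2 = 3 * ρ ^ 2 * Real.sqrt (3 + (M : ℝ))) (hR : R = Real.sqrt R2)
    (hΘ : Θ = ω₂ + 3 * lam * R2 + 4 * (1 + 12 * β * R2))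
    (hreg : 2 * Real.exp 1 * (Real.sqrt Θ * τ) ≤ 2 * M + 1)
    (z : PhaseSpace N) (w : WienerPair) {t : ℝ} (ht : t ∈ Set.Icc (0:ℝ) τ)
    (hXq : ∀ s ∈ Set.Icc (0:ℝ) τ, ∀ l : Fin N,
      ((pinnedChain ω₂ lam β γ).solMap N T T s z w).1 l ^ 2 ≤ ρ ^ 2 * Real.sqrt (1 + ((((l : ℕ) : ℤ) - k).natAbs : ℝ)))
    (hYint : ∀ l : Fin N, ∫ r in (0:ℝ)..τ,
      (severedFlow hB1 (Finset.Icc ((k.val : ℤ) - M) ((k.val : ℤ) + 1 + M)) r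
        (embed (Finset.Icc (0 : ℤ) (0 + N - 1)) e η₀ z) ((l : ℕ) : ℤ)).2 ^ 2 ≤
        ρ ^ 2 * Real.sqrt (1 + ((((l : ℕ) : ℤ) - k).natAbs : ℝ)) / (4 * τ)) :
    ((pinnedChain ω₂ lam β γ).bondCurrent N k ((pinnedChain ω₂ lam β γ).solMap N T T t z w) -
        (pinnedChain ω₂ lam β γ).bondCurrentZ
          (severedFlow hB1 (Finset.Icc ((k.val : ℤ) - M) ((k.val : ℤ) + 1 + M)) t
            (embed (Finset.Icc (0 : ℤ) (0 + N - 1)) e η₀ z)) (k.val : ℤ)) ^ 2 ≤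
      2 * (2 * R + 8 * β * R ^ 3) ^ 2 * (2 * R * Real.sqrt Θ * (1 / 2) ^ (2 * M + 1)) ^ 2 +
        2 * (1 + 12 * β * R ^ 2) ^ 2 * (2 * R * (1 / 2) ^ (2 * M + 2)) ^ 2 *
          ((severedFlow hB1 (Finset.Icc ((k.val : ℤ) - M) ((k.val : ℤ) + 1 + M)) t
              (embed (Finset.Icc (0 : ℤ) (0 + N - 1)) e η₀ z) (k.val : ℤ)).2 +
            (severedFlow hB1 (Finset.Icc ((k.val : ℤ) - M) ((k.val : ℤ) + 1 + M)) t
              (embed (Finset.Icc (0 : ℤ) (0 + N - 1)) e η₀ z) ((k.val : ℤ) + 1)).2) ^ 2 := by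
  set P := pinnedChain ω₂ lam β γ with hP
  have hk1 : k.val + 1 < N := by omega
  set k1 : Fin N := ⟨k.val + 1, hk1⟩ with hk1def
  have hk1z : (((k1 : Fin N) : ℕ) : ℤ) = (k.val : ℤ) + 1 := by rw [hk1def]; push_cast; ring
  set Λ : Finset ℤ := Finset.Icc ((k.val : ℤ) - M) ((k.val : ℤ) + 1 + M) with hΛ
  set ι := embed (Finset.Icc (0 : ℤ) (0 + N - 1)) e η₀ with hι
  have hιapp : ∀ (z : PhaseSpace N) (l : Fin N), ι z ((l : ℕ) : ℤ) = (z.1 l, z.2 l) := embed_Icc_zero_apply e he η₀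
  have hιc : Continuous ι := continuous_embed e η₀
  have hR20 : 0 ≤ R2 := by rw [hR2]; positivity
  have hRR : R ^ 2 = R2 := by rw [hR]; exact Real.sq_sqrt hR20
  -- the strong solution in `ℤ`-coordinates
  set cT : ℝ := Real.sqrt (2 * P.γ * T) with hcT
  have hsol : ∀ u : ℝ, P.solMap N T T u z w = P.chainFlow N z (chainNoise N cT cT w) u := fun _ => rfl
  -- chain indices of the window sites
  have hwin : ∀ j : ℤ, (k.val : ℤ) - M - 1 ≤ j → j ≤ (k.val : ℤ) + M + 2 →
      ∃ l : Fin N, ((l : ℕ) : ℤ) = j ∧ Real.sqrt (1 + ((((l : ℕ) : ℤ) - k).natAbs : ℝ)) ≤ Real.sqrt (3 + (M : ℝ)) := by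
    intro j hj1 hj2
    refine ⟨⟨j.toNat, by omega⟩, by simp only; omega, Real.sqrt_le_sqrt ?_⟩
    have : ((((⟨j.toNat, by omega⟩ : Fin N) : ℕ) : ℤ) - k).natAbs ≤ M + 2 := by simp only; omega
    have := (Nat.cast_le (α := ℝ)).2 this
    push_cast at this ⊢
    linarith
  -- positions of the strong solution: `q² ≤ ρ² g ≤ R²`
  have hρg : ∀ {x : ℝ}, x ≤ Real.sqrt (3 + (M : ℝ)) → ρ ^ 2 * x ≤ R2 / 3 := fun hx => by
    rw [hR2]; have := mul_le_mul_of_nonneg_left hx (sq_nonneg ρ); linarith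
  have habsR : ∀ {x : ℝ}, x ^ 2 ≤ R2 → |x| ≤ R := fun hx => by
    rw [← Real.sqrt_sq_eq_abs, hR]; exact Real.sqrt_le_sqrt hx
  have hXbox : ∀ s ∈ Set.Icc (0:ℝ) τ, ∀ l : Fin N,
      Real.sqrt (1 + ((((l : ℕ) : ℤ) - k).natAbs : ℝ)) ≤ Real.sqrt (3 + (M : ℝ)) →
      |(P.solMap N T T s z w).1 l| ≤ R := fun s hs l hl' => habsR (by linarith [hXq s hs l, hρg hl', hR20])
  -- positions of the severed flow: `q² ≤ 3ρ²√(3+M) = R²`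
  have hYbox : ∀ s ∈ Set.Icc (0:ℝ) τ, ∀ l : Fin N,
      Real.sqrt (1 + ((((l : ℕ) : ℤ) - k).natAbs : ℝ)) ≤ Real.sqrt (3 + (M : ℝ)) →
      |(severedFlow hB1 Λ s (ι z) ((l : ℕ) : ℤ)).1| ≤ R := by
    intro s hs l hl'
    have hz0 : (z.1 l) ^ 2 ≤ ρ ^ 2 * Real.sqrt (1 + ((((l : ℕ) : ℤ) - k).natAbs : ℝ)) := by
      have h0 := hXq 0 ⟨le_rfl, hτ.le⟩ l
      rwa [pinnedChain_solMap_of_nonpos N T T z w le_rfl] at h0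
    have hι1 : (ι z ((l : ℕ) : ℤ)).1 = z.1 l := by rw [hιapp]
    refine habsR ?_
    by_cases hlΛ : ((l : ℕ) : ℤ) ∈ Λ
    · have hkin := severedFlow_position_sq_le hB1 Λ (ι z) hlΛ (t := τ) hs
      rw [hι1] at hkin
      have h4 : 2 * τ * ∫ r in (0:ℝ)..τ, (severedFlow hB1 Λ r (ι z) ((l : ℕ) : ℤ)).2 ^ 2 ≤
          ρ ^ 2 * Real.sqrt (1 + ((((l : ℕ) : ℤ) - k).natAbs : ℝ)) / 2 :=
        calc _ ≤ 2 * τ * (ρ ^ 2 * Real.sqrt (1 + ((((l : ℕ) : ℤ) - k).natAbs : ℝ)) / (4 * τ)) :=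
              mul_le_mul_of_nonneg_left (hYint l) (by positivity)
          _ = _ := by field_simp; ring
      linarith [hkin, hz0, h4, hρg hl', hR20]
    · rw [severedFlow_apply_of_not_mem hB1 Λ s (ι z) hlΛ, hι1]
      linarith [hz0, hρg hl', hR20]
  -- the box hypothesis of the pathwise core
  have hpbox : ∀ s ∈ Set.Icc (0:ℝ) t, ∀ j : ℤ, (k.val : ℤ) - M - 1 ≤ j → j ≤ (k.val : ℤ) + M + 2 →
      |(ι (P.chainFlow N z (chainNoise N cT cT w) s) j).1| ≤ R ∧ |(severedFlow hB1 Λ s (ι z) j).1| ≤ R := by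
    intro s hs j hj1 hj2
    obtain ⟨l, rfl, hl'⟩ := hwin j hj1 hj2
    have hsτ : s ∈ Set.Icc (0:ℝ) τ := ⟨hs.1, hs.2.trans ht.2⟩
    refine ⟨?_, hYbox s hsτ l hl'⟩
    rw [hιapp, ← hsol]; exact hXbox s hsτ l hl'
  have hreg' : 2 * Real.exp 1 * (Real.sqrt (ω₂ + 3 * lam * R ^ 2 + 4 * (1 + 12 * β * R ^ 2)) * t) ≤ 2 * M + 1 := by
    rw [hRR, ← hΘ]
    refine le_trans ?_ hreg
    have : Real.sqrt Θ * t ≤ Real.sqrt Θ * τ := mul_le_mul_of_nonneg_left ht.2 (Real.sqrt_nonneg _)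
    exact mul_le_mul_of_nonneg_left this (by positivity)
  set δq : ℝ := 2 * R * (1 / 2) ^ (2 * M + 2) with hδq
  set δp : ℝ := 2 * R * Real.sqrt Θ * (1 / 2) ^ (2 * M + 1) with hδp
  have hcore : ∀ i : ℤ, (k.val : ℤ) ≤ i → i ≤ (k.val : ℤ) + 1 →
      |(ι (P.chainFlow N z (chainNoise N cT cT w) t) i).1 - (severedFlow hB1 Λ t (ι z) i).1| ≤ δq ∧
      |(ι (P.chainFlow N z (chainNoise N cT cT w) t) i).2 - (severedFlow hB1 Λ t (ι z) i).2| ≤ δp := by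
    intro i hi1 hi2
    have h := central_bond_estimate hω hl hβ hγ hB1 hιc hιapp z cT cT w k hk hkN ht.1 hpbox hreg' i hi1 hi2
    rwa [hRR, ← hΘ] at h
  obtain ⟨hq0, hp0⟩ := hcore (k.val : ℤ) le_rfl (by omega)
  obtain ⟨hq1, hp1⟩ := hcore ((k.val : ℤ) + 1) (by omega) le_rfl
  -- read the strong solution at the central bond in `ℤ`-coordinates
  set X := P.solMap N T T t z w with hX
  set Y := severedFlow hB1 Λ t (ι z) with hY
  have eXk : ι (P.chainFlow N z (chainNoise N cT cT w) t) (k.val : ℤ) = (X.1 k, X.2 k) := by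
    rw [← hsol, show (k.val : ℤ) = (((k : Fin N) : ℕ) : ℤ) from rfl, hιapp]
  have eXk1 : ι (P.chainFlow N z (chainNoise N cT cT w) t) ((k.val : ℤ) + 1) = (X.1 k1, X.2 k1) := by
    rw [← hsol, ← hk1z, hιapp]
  rw [eXk] at hq0 hp0; rw [eXk1] at hq1 hp1
  simp only at hq0 hp0 hq1 hp1
  -- the four positions at time `t` are in the box
  have hM0 : (0 : ℝ) ≤ M := M.cast_nonneg
  have hgk : Real.sqrt (1 + (((((k : Fin N) : ℕ) : ℤ) - k).natAbs : ℝ)) ≤ Real.sqrt (3 + (M : ℝ)) := by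
    refine Real.sqrt_le_sqrt ?_
    rw [show ((((k : Fin N) : ℕ) : ℤ) - k).natAbs = 0 by omega]
    push_cast; linarith
  have hgk1 : Real.sqrt (1 + (((((k1 : Fin N) : ℕ) : ℤ) - k).natAbs : ℝ)) ≤ Real.sqrt (3 + (M : ℝ)) := by
    refine Real.sqrt_le_sqrt ?_
    rw [hk1z, show (((k.val : ℤ) + 1) - k).natAbs = 1 by omega]
    push_cast; linarith
  have bXk := hXbox t ht k hgk; have bXk1 := hXbox t ht k1 hgk1
  have bYk := hYbox t ht k hgk; have bYk1 := hYbox t ht k1 hgk1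
  rw [hk1z] at bYk1
  -- the two currents in closed form
  have hJe : P.bondCurrent N k X = -((X.2 k + X.2 k1) / 2 * ((X.1 k1 - X.1 k) + β * (X.1 k1 - X.1 k) ^ 3)) := by
    rw [bondCurrent_eq_of_lt _ hk1, pinnedChain_deriv_V]
  have hJ'e : P.bondCurrentZ Y (k.val : ℤ) = -(((Y (k.val : ℤ)).2 + (Y ((k.val : ℤ) + 1)).2) / 2 *
      (((Y ((k.val : ℤ) + 1)).1 - (Y (k.val : ℤ)).1) + β * ((Y ((k.val : ℤ) + 1)).1 - (Y (k.val : ℤ)).1) ^ 3)) := by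
    rw [OscillatorChain.bondCurrentZ, pinnedChain_deriv_V]
  show (P.bondCurrent N k X - P.bondCurrentZ Y (k.val : ℤ)) ^ 2 ≤ _
  rw [hJe, hJ'e]
  exact sq_current_sub_le hβ (R := R) (δq := δq) (δp := δp) bXk bXk1 bYk bYk1 hq0 hq1 hp0 hp1

end Window

end SeveredLocality

open SeveredLocality in
/-- **Registered helper `pinnedChain_severedWindow_exceptionalSet`** (probabilistic input of stub (M1sev)
`stub_openChainSeveredLocality`, line `series-law-at-every-laplace-frequency`): under the free finite-volume Gibbs
state of the pinned anharmonic chain, the exceptional set of the weighted time-integrated momentum box ALONG THE SEVERED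
FLOW of the window `[k-M, k+1+M]` started from the embedded configuration has measure `≤ 4^{16}C_pτ^{32}·4/ρ^{32}`,
`C_p = T^{16}∏_{j<16}(2j+1)`, uniformly in the length `N`, the depth `M` and the centre `k`. [folklore] -/
theorem pinnedChain_severedWindow_exceptionalSet :
    ∀ ω₂ lam β γ : ℝ, 0 < ω₂ → 0 ≤ lam → 0 ≤ β → ∀ T : ℝ, 0 < T →
      ∀ (hB1 : (Literature.MathematicalPhysics.KineticTheory.HeatConduction.pinnedChain ω₂ lam β γ).CondB1) (N : ℕ)
        (e : Fin N ≃ ↥(Finset.Icc (0 : ℤ) (0 + N - 1))),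
        (∀ k : Fin N, ((e k : ↥(Finset.Icc (0 : ℤ) (0 + N - 1))) : ℤ) = 0 + k) →
        ∀ (η₀ : Literature.MathematicalPhysics.KineticTheory.HeatConduction.ChainConfig) (k : Fin N) (M : ℕ),
          M + 2 ≤ k.val → k.val + M + 3 < N → ∀ (ρ τ : ℝ), 1 ≤ ρ → 0 < τ →
          MeasurableSet {z : Literature.MathematicalPhysics.KineticTheory.HeatConduction.PhaseSpace N | ∃ l : Fin N,
              ρ ^ 2 * Real.sqrt (1 + ((((l : ℕ) : ℤ) - k).natAbs : ℝ)) / (4 * τ) <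
                ∫ r in (0:ℝ)..τ, (Literature.MathematicalPhysics.KineticTheory.HeatConduction.OscillatorChain.severedFlow
                  hB1 (Finset.Icc ((k.val : ℤ) - M) ((k.val : ℤ) + 1 + M)) r
                  (Literature.MathematicalPhysics.KineticTheory.HeatConduction.OscillatorChain.embed
                    (Finset.Icc (0 : ℤ) (0 + N - 1)) e η₀ z) ((l : ℕ) : ℤ)).2 ^ 2} ∧
          (Literature.MathematicalPhysics.KineticTheory.HeatConduction.pinnedChain ω₂ lam β γ).gibbsMeasure N T
              {z : Literature.MathematicalPhysics.KineticTheory.HeatConduction.PhaseSpace N | ∃ l : Fin N,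
                ρ ^ 2 * Real.sqrt (1 + ((((l : ℕ) : ℤ) - k).natAbs : ℝ)) / (4 * τ) <
                  ∫ r in (0:ℝ)..τ, (Literature.MathematicalPhysics.KineticTheory.HeatConduction.OscillatorChain.severedFlow
                    hB1 (Finset.Icc ((k.val : ℤ) - M) ((k.val : ℤ) + 1 + M)) r
                    (Literature.MathematicalPhysics.KineticTheory.HeatConduction.OscillatorChain.embed
                      (Finset.Icc (0 : ℤ) (0 + N - 1)) e η₀ z) ((l : ℕ) : ℤ)).2 ^ 2} ≤
            ENNReal.ofReal (4 ^ 16 * (T ^ 16 * ∏ j ∈ Finset.range 16, (2 * (j : ℝ) + 1)) * τ ^ 32 / ρ ^ 32 * 4) :=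
  fun _ _ _ γ hω hl hβ _ hT hB1 _ e he η₀ k _ hk hkN _ _ hρ hτ =>
    severed_excSet (γ := γ) hω hl hβ hT hB1 e he η₀ k hk hkN hρ hτ

end Summit.AtomisticToContinuum.FouriersLaw.Theorems.AbelThermodynamicLimit.SeriesLawAtEveryLaplaceFrequency

end
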